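import Mathlib
import Summits.NavierStokesRegularity.NavierStokesRegularity.Theorems.ThreadingFluxAzimuthalCartanCrossFlowNoAxis
import HarnessLib

/-!
# Crux `PoloidalLiouville` (stmt-NavierStokesRegularity-1222, wall W1), crux idea «azimuthal-cartan-test» (ns-idea-15 g10):
# ★ K♭ `SectorialCrossFlows` BY NAME — and the nonlinear BALL statement C♭ is FALSE

Support file (`--supports stmt-NavierStokesRegularity-1222`, helper; cell `ns-wall-extremal`, width hand ns-wall-eng-7 g7, 0 kit).
Assembly of the K♭ chain (`…HalfSpaceCoords`, `…LocalCurlCurl`, `…HalfSpacePotential`, `…CrossFlowAxial`, `…CrossFlowField`,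
`…CrossFlowSteadyNS`, `…CrossFlowNoAxis`) into the Defs-twin Props (`ThreadingFluxAzimuthalCartanDefs.lean`, bodies VERBATIM =
`Cruxes/PoloidalLiouville/AzimuthalCartanSketch.lean` v1.3c):

* ★ `sectorialCrossFlows : SectorialCrossFlows` — for every `γ ≠ 0`, on `ball xTest 1` with centre `0`: `crossFlow γ`, `crossFlowPressure γ`
  are an ANALYTIC STEADY NAVIER–STOKES FLOW, UNTHREADED about `0`, with `curl ≢ 0`, NOT (−1)-homogeneous about `0`, and with NO axis
  `A` (skew, `≠ 0`) of infinitesimal equivariance (let alone constant swirl);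
* `sectorialCrossFlowOne : SectorialCrossFlowOne` (the `γ = 1` instance the sketch glue consumes);
* ★ `not_steadyLocalRigidityOffCentre : ¬ SteadyLocalRigidityOffCentre` and `not_steadyLocalRigidityOffCentreUnrestricted` — the
  sketch's glue `crossFlows_refute_ballRigidity` / `crossFlows_refute_unrestricted` re-proved Theorems-side (three lines each; the twin
  deliberately carries no glue).

READING (critic of record ns-wall-crit-1 g5, V26-R2 07:35:39Z, register line): «BALL-LOCAL steady unthreaded rigidity OFF the centre is
FALSE (exact non-axisymmetric unthreaded steady NS flows exist on every ball missing the axis); the surviving shapes are C♯ (full shells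
about x₀), balls MEETING the axis through x₀, and global statements».  HONEST FRAME: a negative-side kernel fact about one idea card's
typed local statement; W1 movement 0; C♯ / I♭ / `PoloidalLiouville` (1222) and NS regularity OPEN — not proved; 0 kit.
-/

-- the summit and its single sub-problem share the name (CONVENTIONS §1)
set_option linter.dupNamespace false

noncomputable section

namespace Summit.NavierStokesRegularity.NavierStokesRegularity.Theorems.PoloidalLiouville.AzimuthalCartan

open Set Function Filter Topology Metric
open scoped RealInnerProductSpace
open Summit.NavierStokesRegularity.NavierStokesRegularity.Theorems.PoloidalLiouville.AzimuthalCartan.HalfSpace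
open Summit.NavierStokesRegularity.NavierStokesRegularity.Theorems.PoloidalLiouville.AzimuthalCartan.CrossFlow

/-- ★ **K♭ `SectorialCrossFlows` holds.** -/
theorem sectorialCrossFlows : SectorialCrossFlows := fun γ hγ =>
  ⟨analyticOnNhd_crossFlow_ball γ, analyticOnNhd_crossFlowPressure_ball γ, isSteadyNSOn_crossFlow γ,
    fun _ hx => inner_self_curl_crossFlow γ (apply_zero_pos_of_mem_ball hx), exists_curl_crossFlow_ne_zero γ,
    not_isMinusOneHomogeneousOn_crossFlow γ hγ, crossFlow_noAxis γ hγ⟩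

/-- **K♭₁ `SectorialCrossFlowOne` holds** (the `γ = 1` instance). -/
theorem sectorialCrossFlowOne : SectorialCrossFlowOne := sectorialCrossFlows 1 one_ne_zero

/-- ★ **C♭ `SteadyLocalRigidityOffCentre` is FALSE**: the sectorial cross flow with `γ = 1` on `ball (3,0,4) 1`, centre `0`, satisfies
every hypothesis (analytic steady NS, unthreaded, `curl ≢ 0`, not (−1)-homogeneous) and violates the conclusion (no axis). -/
theorem not_steadyLocalRigidityOffCentre : ¬ SteadyLocalRigidityOffCentre := by
  intro hC
  obtain ⟨hV, hp, hNS, hU, hcurl, hhom, hnot⟩ := sectorialCrossFlows 1 one_ne_zero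
  exact hnot (hC (crossFlow 1) (crossFlowPressure 1) 0 xTest 1 one_pos hV hp hNS hU hcurl hhom)

/-- **C♭₀ `SteadyLocalRigidityOffCentreUnrestricted` is FALSE** as well (a second, elementary death next to the conical flows K♯). -/
theorem not_steadyLocalRigidityOffCentreUnrestricted : ¬ SteadyLocalRigidityOffCentreUnrestricted := by
  intro hC
  obtain ⟨hV, hp, hNS, hU, hcurl, -, hnot⟩ := sectorialCrossFlows 1 one_ne_zero
  exact hnot (hC (crossFlow 1) (crossFlowPressure 1) 0 xTest 1 one_pos hV hp hNS hU hcurl)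

end Summit.NavierStokesRegularity.NavierStokesRegularity.Theorems.PoloidalLiouville.AzimuthalCartan

end
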